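import Literature.Computability.Complexity.FoldCatBricks
import HarnessLib

/-!
# Fold bricks, polynomial form II: `foldSum` and `foldProd` (sums and products of piece values in `FP`)

Trunk toolkit continuing `FoldCatBricks.lean` (`Brick.foldCat Q p f ⟨x, u⟩`: the CONCATENATION of the
pieces `f ⟨x, 1ᵗ⟩`, `t < |u|`, each clipped polynomially by `pclipF Q`). The two arithmetic instances
of the same counted fold (`Brick.foldLoop` with `addFn` / `prodFn`, models `foldAcc_addFn` /
`foldAcc_prodFn` of `FoldBricks.lean`):

* `Brick.foldSum Q p f ⟨x, u⟩ = ⌜∑_{t<|u|} ⟦f ⟨x, 1ᵗ⟩⟧⌝` (`foldSum_apply`, `foldSum_mem_FP`);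
* `Brick.foldProd Q p f ⟨x, u⟩ = ⌜∏_{t<|u|} ⟦f ⟨x, 1ᵗ⟩⟧⌝` (`foldProd_apply`, `foldProd_mem_FP`),

valid when `|u| ≤ p (|x|)` rounds are available and every folded piece has at most `Q (|x|)` symbols.
Used by the Manders–Adleman machine (`QuadraticCongruencesMachine.lean`: `K = ∏ pⱼ^e`, `H = ∑ θⱼ`)
and the SUBSET SUM machine (`OneInThreeSubsetSumMachine.lean`: the numbers `∑ 4^{pos}`).

## References

* S. Arora, B. Barak, *Computational Complexity: A Modern Approach*, CUP 2009, §1.3 (polynomial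
  time is closed under composition and polynomially bounded loops), §1.4.1 (clocked loops).
-/

noncomputable section

namespace Literature.Computability.Complexity

open _root_.Computability Polynomial Finset

namespace Brick

/-- The loop record of a product fold: `⟨x, ⟨bin |u|, ⟨ε, ⌜1⌝⟩⟩⟩` from `⟨x, u⟩` (countdown `|u|`, index
`1⁰`, accumulator `⌜1⌝`). [folklore] -/
def prodInit : List Bool → List Bool :=
  fanoutFn fstF (fanoutFn (lenBinF ∘ sndF) (fun _ => boolPair [] [true]))

/-- `prodInit` on a pair. [folklore] -/
@[simp] theorem prodInit_boolPair (x u : List Bool) :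
    prodInit (boolPair x u) = boolPair x (boolPair (encodeNat u.length) (boolPair [] [true])) := by
  simp [prodInit]

/-- `prodInit ∈ FP`. [folklore] -/
theorem prodInit_mem_FP : prodInit ∈ FP :=
  fanoutFn_mem_FP fstF_mem_FP (fanoutFn_mem_FP (comp_mem_FP lenBinF_mem_FP sndF_mem_FP) (const_mem_FP _))

/-- **The sum fold** `foldSum Q p f`: on `⟨x, u⟩`, the canonical numeral of `∑_{t<|u|} ⟦f ⟨x, 1ᵗ⟩⟧`
(pieces clipped to `Q (|x|)` symbols, `p (|x|)` rounds available). [cite: AroraBarak2009, §1.3 (bounded loops)] -/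
def foldSum (Q p : Polynomial ℕ) (f : List Bool → List Bool) : List Bool → List Bool :=
  sndPow 2 ∘ foldLoop addFn (pclipF Q f) p ∘ foldCatInit

/-- **`foldSum Q p f ∈ FP`** for `f ∈ FP`. [cite: AroraBarak2009, §1.3 (bounded loops), §1.4.1] -/
theorem foldSum_mem_FP (Q p : Polynomial ℕ) {f : List Bool → List Bool} (hf : f ∈ FP) : foldSum Q p f ∈ FP :=
  comp_mem_FP (sndPow_mem_FP 2)
    (comp_mem_FP (foldLoop_pclipF_mem_FP Q addFn_mem_FP length_addFn_le hf p) foldCatInit_mem_FP)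

/-- **Semantics of `foldSum`**: with `|u| ≤ p (|x|)` rounds available and the folded pieces within the
clip, `foldSum Q p f ⟨x, u⟩ = ⌜∑_{t<|u|} ⟦f ⟨x, 1ᵗ⟩⟧⌝`. [folklore] -/
theorem foldSum_apply {Q p : Polynomial ℕ} {f : List Bool → List Bool} {x u : List Bool}
    (hk : u.length ≤ p.eval x.length) (hQ : ∀ t, t < u.length → (f (boolPair x (ones t))).length ≤ Q.eval x.length) :
    foldSum Q p f (boolPair x u) = encodeNat (∑ t ∈ range u.length, bitsToNat (f (boolPair x (ones t)))) := by
  rw [foldSum, Function.comp_apply, Function.comp_apply, foldCatInit_boolPair,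
    show boolPair ([] : List Bool) [] = boolPair (ones 0) (encodeNat 0) from rfl, foldLoop_apply _ _ hk,
    foldAcc_pclipF (fun j _ hj => hQ j (by omega)), foldAcc_addFn]
  simp

/-- **The product fold** `foldProd Q p f`: on `⟨x, u⟩`, the canonical numeral of `∏_{t<|u|} ⟦f ⟨x, 1ᵗ⟩⟧`.
[cite: AroraBarak2009, §1.3 (bounded loops)] -/
def foldProd (Q p : Polynomial ℕ) (f : List Bool → List Bool) : List Bool → List Bool :=
  sndPow 2 ∘ foldLoop prodFn (pclipF Q f) p ∘ prodInit

/-- **`foldProd Q p f ∈ FP`** for `f ∈ FP`. [cite: AroraBarak2009, §1.3 (bounded loops), §1.4.1] -/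
theorem foldProd_mem_FP (Q p : Polynomial ℕ) {f : List Bool → List Bool} (hf : f ∈ FP) : foldProd Q p f ∈ FP :=
  comp_mem_FP (sndPow_mem_FP 2)
    (comp_mem_FP (foldLoop_pclipF_mem_FP Q prodFn_mem_FP length_prodFn_le hf p) prodInit_mem_FP)

/-- **Semantics of `foldProd`.** [folklore] -/
theorem foldProd_apply {Q p : Polynomial ℕ} {f : List Bool → List Bool} {x u : List Bool}
    (hk : u.length ≤ p.eval x.length) (hQ : ∀ t, t < u.length → (f (boolPair x (ones t))).length ≤ Q.eval x.length) :
    foldProd Q p f (boolPair x u) = encodeNat (∏ t ∈ range u.length, bitsToNat (f (boolPair x (ones t)))) := by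
  rw [foldProd, Function.comp_apply, Function.comp_apply, prodInit_boolPair,
    show boolPair ([] : List Bool) [true] = boolPair (ones 0) (encodeNat 1) from rfl, foldLoop_apply _ _ hk,
    foldAcc_pclipF (fun j _ hj => hQ j (by omega)), foldAcc_prodFn]
  simp

end Brick

end Literature.Computability.Complexity

end
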